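import Summits.BirchSwinnertonDyer.Rank1Residual.GaloisImage.KuriharaRecordBSDpThreeLevelOneEndOfBaseRigidity
import Summits.BirchSwinnertonDyer.Rank1Residual.GaloisImage.KuriharaRecordBSDpThreeLevelOneEndOfFacts
import HarnessLib

/-!
# END-m1 record corollaries at LARGE LEVEL (`N > 130000`, (M) and potentially GOOD rows): the Manin
# input as a per-pair binder `3 ∤ c_D` instead of Agashe–Ribet–Stein Thm. 2.6 (cell `b2b-bsdres`,
# team n1011, seat p03, OWNERS row T-R1-57-REC record-side tool; twins of n1011-p18's
# `GaloisImage/KuriharaRecordBSDpThreeLevelOne[EndOfBaseRigidity|EndOfFacts].lean`)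

HONEST FRAMING (cell `b2b-bsdres`, run/shared/lean/b2b/bsd-rank1-residual/, verbatim in every
file): the goal of the cell is to DELETE the COMBINATION-SHAPED residual classes of the
Birch–Swinnerton-Dyer formula for ALL analytic-rank `≤ 1` elliptic curves over `ℚ` — "full BSD
formula for every rank `≤ 1` curve in class `C`" assembled STRICTLY from published theorems — so
that the rank-`≤ 1` remainder becomes exactly the CONSTRUCTION-SHAPED classes, which are TYPED
(missing-input `Prop`s), NOT attempted. This is not "finishing BSD". Team n1011 (N10/N11, the
additive block `X4 ∧ p = 3`): research route; PER-PAIR record SHAPES, NOT a class theorem; TOOL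
theorems only (no definition, no named fact); nothing booked; no mark / label moved; the shapes
below CLOSE NOTHING.  END-m1 is DEBT REDUCTION, not coverage.

## What and why

The END-m1 record corollaries (p18, m = 1; p03's series of 36 rows) take the Manin input of the
optimal datum through the PUBLISHED fact `cremona_abs_maninConstant_eq_one_of_level_le`
(Agashe–Ribet–Stein 2006 Thm. 2.6: `|c_D| = 1` for optimal curves of conductor `N ≤ 130000`), i.e.
the binders `(h26) (hN : N ≤ 130000)`.  Of the 4 130 class-A1 UNIT `ord₃ #Ш_an = 2` rows of N11
LOWER@3 (r1 ROUTE-1 §33.3; `route1/s20_te_census.tsv`), 3 383 have `N > 130000`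
(`b2b-bsdres-n1011-p03/g7/scale/ENDM1-SCALE-levels.tsv`), 1 322 of them potentially MULTIPLICATIVE at
`3`; there no printed Manin-constant theorem applies at `p = 3` (the curve is ADDITIVE at `3`, so
`9 ∣ N`).  In the (M) chain the ONLY use of `(h26, hN)` is `¬ (3 : ℤ) ∣ D.maninConstant` feeding the
period transfer (`X4.periodTransfer_of_optimal`) — on the UPPER side additive-p1's `ω`-branch socket
(`X4RankZero.bsdp_three_potMult_of_LOmegaWitness_noL20`) needs NO Manin datum.  This file states the
(M)-row END-m1 chain with that line as an explicit PER-PAIR binder `hcD : ¬ (3 : ℤ) ∣ D.maninConstant`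
(EVIDENCE on a record: Cremona's `ecdata` table `opt_man` — a database entry, NOT a printed theorem,
flagged as such in any record that uses it), every other binder unchanged and in p18's order:

* `exists_LOmega_padicValRat_le_of_sq_dvd_card_sha_of_maninUnit` — the level-zero witness
  (`9 ∣ #Ш(3)` ∧ `δ̃_1 ≢ 0 (mod 27)` ⟹ `∃ q, L/Ω = q ∧ ord₃ q ≤ ord₃ #Ш(3)`);
* `bsdp_three_potMult_of_sq_dvd_card_sha_of_maninUnit` — the (M) socket;
* `bsdp_three_potMult_of_levelOneCertificates_of_baseRigidity_of_maninUnit` — the [S24]-free END;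
* `bsdp_three_potMult_of_levelOneCertificates_of_facts_of_maninUnit` — the NAMED-FACTS END.

For the potentially GOOD rows (`N > 130000`: 1 804 G-ss + 257 G-ord) the same swap is made one level
below: additive-p4's `X4RankZero.bsdp_of_facts_of_LOmegaWitness` takes the Manin datum
`∃ N D, ¬ 3 ∣ c_D` itself, so `⟨N, D, hcD⟩` replaces `exists_maninDatum_of_optimal h26 … hN …` —
`bsdp_three_of_towerSurj_of_sq_dvd_card_sha_of_maninUnit` +
`bsdp_three_of_towerSurj_of_levelOneCertificates_of_baseRigidity_of_maninUnit` (tower form; 6 theorems in all).  For `N ≤ 130000` p18's theorems are recovered by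
`hcD := not_dvd_maninConstant_of_level_le h26 W D hopt hN Nat.prime_three`.  Nothing is booked.

References: C.-H. Kim, AJM 148 (2026) §1.4.3, Thm. 1.9 (6), Thm. 3.13 [Kim2022StructureSelmer];
M. Kurihara, Münster J. Math. 7 (2014) §1.1 [Kurihara2014]; Agashe–Ribet–Stein (2006) §2 (Manin
constant of an optimal quotient; Thm. 2.6 is NOT used) [AgasheRibetStein2006]; J. E. Cremona,
*Algorithms for Modular Elliptic Curves* (1997) §2.9–2.11 + `ecdata` `opt_man` [CremonaAlgorithms1997];
K. Rubin, PCMI 18 (2011) Thm. 2.8.4 [Rubin2011]; D. Delbourgo (1998) Prop. 4 [Delbourgo1998];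
J. H. Silverman, AEC (2009) X.4.14 [SilvermanAEC2009]; cell files cells/n1011/ROUTE-1.md §33.3,
OWNERS.md (T-R1-57-B, T-R1-57-REC).
-/

noncomputable section

open scoped Classical NumberField ContRepresentation
open Function Field NumberField IsDedekindDomain IsDedekindDomain.HeightOneSpectrum WeierstrassCurve
  CongruenceSubgroup
  Literature.NumberTheory.EllipticCurves Literature.NumberTheory.EllipticCurves.ModularForms
  Literature.NumberTheory.EllipticCurves.Rank1Residual
  Literature.NumberTheory.EllipticCurves.AgasheRibetStein2006
  Literature.NumberTheory.GaloisRepresentations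
  Literature.NumberTheory.GaloisRepresentations.DiscreteGaloisModule Literature.NumberTheory.GaloisCohomology
  Rat.HeightOneSpectrum
  Summit.BirchSwinnertonDyer.Rank1Residual.Additive Summit.BirchSwinnertonDyer.Rank1Residual.X4

namespace Summit.BirchSwinnertonDyer.Rank1Residual.GaloisImage.Assembly

/-- **The LEVEL-ZERO WITNESS of END-m1 with the Manin input as a binder.**  Exactly n1011-p18's
`exists_LOmega_padicValRat_le_of_sq_dvd_card_sha` with `(h26) (hN : N ≤ 130000)` replaced by
`hcD : ¬ (3 : ℤ) ∣ D.maninConstant` (the only use of the pair in the original proof): `ρ̄_{E,3}` onto,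
`r_an = 0`, an optimal datum `D` with `3 ∤ c_D` (so `Ω(W) = u·Ω⁺_f`, `|u|₃ = 1`), `9 ∣ #Ш(E)[3^∞]` and
`δ̃_1 ≢ 0 (mod 27)` ⟹ `∃ q, L(E,1)/Ω(W) = q ∧ ord₃ q ≤ ord₃ #Ш(E)[3^∞]`.  Proof = p18's, line for line,
minus the ARS step. [cite: Kim2022StructureSelmer, §1.4.3 (PDF p. 7)] [cite: Kurihara2014, §1.1 (PDF p. 2)]
[cite: AgasheRibetStein2006, §2 (the Manin constant of the optimal quotient)] -/
theorem exists_LOmega_padicValRat_le_of_sq_dvd_card_sha_of_maninUnit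
    (hGZK : rank_eq_analyticRank_of_analyticRank_le_one) (hmod : hasEntireLFunction_rat)
    (W : WeierstrassCurve ℚ) [W.IsElliptic] [W.IsGloballyMinimal]
    (hsurj : W.HasSurjectiveModNGaloisRep 3) (hr : W.analyticRank = 0)
    {N : ℕ} [NeZero N] (D : ModularParametrizationData W N)
    (hopt : ∀ z ∈ D.L.lattice, ∃ w ∈ periodLattice D.f, z = D.c * w)
    (hcD : ¬ (3 : ℤ) ∣ D.maninConstant)
    (h9 : 3 ^ 2 ∣ Nat.card (AddCommGroup.primaryComponent W.sha 3))
    (ψ₂₇ : (ℓ : ℕ) → (ZMod ℓ)ˣ →* Multiplicative (ZMod (3 ^ 3)))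
    (hunit₁ : kuriharaNumber D.f (3 ^ 3) 1 ψ₂₇ ≠ 0) :
    ∃ q : ℚ, W.entireLFunction 1 / (W.realPeriodRat : ℂ) = (q : ℂ) ∧
      padicValRat 3 q ≤ (padicValNat 3 (Nat.card (AddCommGroup.primaryComponent W.sha 3)) : ℤ) := by
  haveI : Fact (Nat.Prime 3) := ⟨Nat.prime_three⟩
  have hL : W.entireLFunction 1 ≠ 0 := by
    rw [← W.leadingLCoeff_eq_of_analyticRank_eq_zero hr]
    exact W.leadingLCoeff_ne_zero_holds (hmod W)
  have hGZ := hGZK W (by rw [hr]; exact zero_le_one)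
  haveI : Finite W.sha := hGZ.2
  have hper : ∃ u : ℚ, ‖(u : ℚ_[3])‖ = 1 ∧ W.realPeriodRat = u * plusPeriod D.f :=
    periodTransfer_of_optimal 3 D hopt hcD
  have hirr : W.HasIrreducibleModPGaloisRep 3 :=
    hasIrreducibleModPGaloisRep_of_hasSurjectiveModNGaloisRep W 3 hsurj
  obtain ⟨q, v, hq, hv, hshape⟩ := LValue.exists_lValue_witness W 3 (by norm_num) hirr hL D hper
  refine ⟨q, hq, ?_⟩
  have hv2 : v ≤ 2 := by
    by_contra hlt
    have h3v : 3 ≤ v := by omega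
    obtain ⟨w₀, hw₀⟩ := hshape 3
    apply hunit₁
    rw [hw₀ ψ₂₇]
    have h27 : ((3 ^ v : ℕ) : ZMod (3 ^ 3)) = 0 := by
      rw [ZMod.natCast_eq_zero_iff]
      exact pow_dvd_pow 3 h3v
    rw [h27, zero_mul]
  have hcard : Nat.card (AddCommGroup.primaryComponent W.sha 3) ≠ 0 := by
    haveI : Finite (AddCommGroup.primaryComponent W.sha 3) := inferInstance
    exact Nat.card_pos.ne'
  have h2 : 2 ≤ padicValNat 3 (Nat.card (AddCommGroup.primaryComponent W.sha 3)) :=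
    (padicValNat_dvd_iff_le hcard).mp h9
  rw [hv]
  exact_mod_cast hv2.trans h2

/-- **The (M) socket with the Manin binder**: n1011-p18's `bsdp_three_potMult_of_sq_dvd_card_sha` with
`(h26, hN)` replaced by `hcD : ¬ (3 : ℤ) ∣ D.maninConstant`; the UPPER half is additive-p1's `ω`-branch
socket `X4RankZero.bsdp_three_potMult_of_LOmegaWitness_noL20` (NO Manin datum there).  CLOSES NOTHING.
[cite: Kim2022StructureSelmer, Thm. 1.9 (6)] [cite: Delbourgo1998, Prop. 4 (p. 144)]
[cite: Kato2004Asterisque, Thm. 14.5 (3) (p. 236)] -/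
theorem bsdp_three_potMult_of_sq_dvd_card_sha_of_maninUnit
    (hKatoS : Kato2004.rankZero_padicValNat_sha_le_sub_localTamagawa_of_additive_potGood_of_imageContainsSL2)
    (hDel : Delbourgo1998.prop4_rankZero_pow_dvd_constantCoeff)
    (hGZK : rank_eq_analyticRank_of_analyticRank_le_one) (hmod : hasEntireLFunction_rat)
    (hmodD : nonempty_modularParametrizationData)
    (hKatoχ : Wuthrich2014.kato_halfEigenCharIdeal_dvd_cyclotomicPrime_of_surjective)
    (W : WeierstrassCurve ℚ) [W.IsElliptic] [W.IsGloballyMinimal]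
    {E₀ : WeierstrassCurve ℤ} (hI : integralModelInt W = E₀)
    (hΔ : (3 : ℤ) ∣ E₀.Δ) (hc₄ : (3 : ℤ) ∣ E₀.c₄)
    (hsurj : W.HasSurjectiveModNGaloisRep 3) (hjneg : padicValRat 3 W.j < 0)
    (hr : W.analyticRank = 0)
    {N : ℕ} [NeZero N] (D : ModularParametrizationData W N)
    (hopt : ∀ z ∈ D.L.lattice, ∃ w ∈ periodLattice D.f, z = D.c * w)
    (hcD : ¬ (3 : ℤ) ∣ D.maninConstant)
    (h9 : 3 ^ 2 ∣ Nat.card (AddCommGroup.primaryComponent W.sha 3))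
    (ψ₂₇ : (ℓ : ℕ) → (ZMod ℓ)ˣ →* Multiplicative (ZMod (3 ^ 3)))
    (hunit₁ : kuriharaNumber D.f (3 ^ 3) 1 ψ₂₇ ≠ 0) :
    BSDp W 3 := by
  haveI : Fact (Nat.Prime 3) := ⟨Nat.prime_three⟩
  have hadd : Addv W 3 := addv_of_intModel hI 3 (by exact_mod_cast hΔ) (by exact_mod_cast hc₄)
  have hX : ClassX4 W 3 :=
    ⟨by norm_num, hadd, hasIrreducibleModPGaloisRep_of_hasSurjectiveModNGaloisRep W 3 hsurj⟩
  obtain ⟨q₀, hq₀, hw⟩ := exists_LOmega_padicValRat_le_of_sq_dvd_card_sha_of_maninUnit hGZK hmod W hsurj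
    hr D hopt hcD h9 ψ₂₇ hunit₁
  exact X4RankZero.bsdp_three_potMult_of_LOmegaWitness_noL20 W hKatoS hDel hGZK hmod hmodD hKatoχ hr
    hX hsurj hjneg hq₀ (j := 0) (Nat.zero_le _) (by simpa using hw)

/-- **END-m1 RECORD COROLLARY, (M) rows, [S24]-FREE, at LARGE LEVEL (Manin binder per pair).**  Exactly
n1011-p18's `bsdp_three_potMult_of_levelOneCertificates_of_baseRigidity` with `(h26) (hN : N ≤ 130000)`
replaced by `hcD : ¬ (3 : ℤ) ∣ D.maninConstant` (per-pair EVIDENCE binder — Cremona `opt_man` — on rows with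
`N > 130000`; for `N ≤ 130000` feed `not_dvd_maninConstant_of_level_le h26 W D hopt hN Nat.prime_three`);
every other binder unchanged and in the same order.  LOWER: n1011-p09's [S24]-free END-m1 (base rigidity)
⟹ `Sel₃ ≠ 0` ⟹ `9 ∣ #Ш(3)` (Cassels–Tate); UPPER: the `ω`-branch socket.  CLOSES NOTHING; the Kurihara
values stay EVIDENCE hypotheses; nothing booked.
[cite: Kim2022StructureSelmer, Thm. 1.9 (6) and Thm. 3.13] [cite: Rubin2011, Thm. 2.8.4]
[cite: Delbourgo1998, Prop. 4 (p. 144)] [cite: AgasheRibetStein2006, §2] [cite: SilvermanAEC2009, Thm. X.4.14] -/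
theorem bsdp_three_potMult_of_levelOneCertificates_of_baseRigidity_of_maninUnit
    (hKatoS : Kato2004.rankZero_padicValNat_sha_le_sub_localTamagawa_of_additive_potGood_of_imageContainsSL2)
    (hDel : Delbourgo1998.prop4_rankZero_pow_dvd_constantCoeff)
    (hGZK : rank_eq_analyticRank_of_analyticRank_le_one) (hmod : hasEntireLFunction_rat)
    (hmodD : nonempty_modularParametrizationData)
    (hKatoχ : Wuthrich2014.kato_halfEigenCharIdeal_dvd_cyclotomicPrime_of_surjective)
    (hCT : exists_casselsTate_pairing (K := ℚ))
    (W : WeierstrassCurve ℚ) [W.IsElliptic] [W.IsGloballyMinimal]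
    {E₀ : WeierstrassCurve ℤ} (hI : integralModelInt W = E₀)
    (hΔ : (3 : ℤ) ∣ E₀.Δ) (hc₄ : (3 : ℤ) ∣ E₀.c₄)
    (hsurj : W.HasSurjectiveModNGaloisRep ((3 : ℕ) : ℤ)) (hjneg : padicValRat 3 W.j < 0)
    (hc3 : ¬ 3 ∣ (W.baseChange ℚ_[3]).localTamagawaNumber ℤ_[3])
    (ht0 : Nat.card {Q : (W.baseChange ℚ_[3]).toAffine.Point // (3 : ℕ) • Q = 0} = 1)
    (hr : W.analyticRank = 0)
    {N : ℕ} [NeZero N] (D : ModularParametrizationData W N)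
    (hopt : ∀ z ∈ D.L.lattice, ∃ w ∈ periodLattice D.f, z = D.c * w)
    (hcD : ¬ (3 : ℤ) ∣ D.maninConstant)
    (inv : LocalInvariants ℚ 3) (hperf : inv.IsPerfect) (hsum : inv.SumLocalTermEqZero)
    (hcompl : inv.SelmerComplement)
    (hEP : ∀ v : HeightOneSpectrum (𝓞 ℚ), localEulerPoincareCharacteristic (v.adicCompletion ℚ))
    (v₃ : HeightOneSpectrum (𝓞 ℚ)) (hv₃ : ((3 : ℕ) : 𝓞 ℚ) ∈ v₃.asIdeal)
    (hPort : KatoKuriharaPortThreeAt W 0 v₃)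
    (n : ℕ) [NeZero n] (hn : Kato.IsKolyvaginProduct W 3 1 n)
    (hcyc : ∀ (ℓ : ℕ) [Fact ℓ.Prime], ℓ ∣ n →
      Nat.card {P : ((integralModelInt W).map (Int.castRingHom (ZMod ℓ))).toAffine.Point //
        3 • P = 0} ≤ 3)
    (ψ : (ℓ : ℕ) → (ZMod ℓ)ˣ →* Multiplicative (ZMod (3 ^ 1)))
    (hψ : ∀ ℓ ∈ n.primeFactors, Function.Surjective (ψ ℓ))
    (hcert : kuriharaNumber D.f (3 ^ 1) n ψ ≠ 0)
    (hzero₁ : kuriharaNumber D.f (3 ^ 1) 1 ψ = 0)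
    (ψ₂₇ : (ℓ : ℕ) → (ZMod ℓ)ˣ →* Multiplicative (ZMod (3 ^ 3)))
    (hunit₁ : kuriharaNumber D.f (3 ^ 3) 1 ψ₂₇ ≠ 0) :
    BSDp W 3 := by
  haveI : Fact (Nat.Prime 3) := ⟨Nat.prime_three⟩
  have hadd : Addv W 3 := addv_of_intModel hI 3 (by exact_mod_cast hΔ) (by exact_mod_cast hc₄)
  have hsurj' : W.HasSurjectiveModNGaloisRep 3 := by simpa using hsurj
  have hGZ := hGZK W (by rw [hr]; exact zero_le_one)
  haveI : Finite W.sha := hGZ.2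
  haveI : Finite W.toAffine.Point := W.mordellWeilRank_eq_zero_iff_holds.mp (by rw [hGZ.1, hr])
  have hirr : W.HasIrreducibleModPGaloisRep 3 :=
    hasIrreducibleModPGaloisRep_of_hasSurjectiveModNGaloisRep W 3 hsurj'
  have hper : ∃ u : ℚ, ‖(u : ℚ_[3])‖ = 1 ∧ W.realPeriodRat = u * plusPeriod D.f :=
    periodTransfer_of_optimal 3 D hopt hcD
  have hcP : ¬ ((3 : ℕ) : ℤ) ∣ D.maninConstant := by exact_mod_cast hcD
  have hSel := exists_ne_zero_mem_selmerGroup_three_of_port_of_kolyvaginProduct_of_baseRigidity W hadd hc3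
    hsurj ht0 D hcP hper inv hperf hsum hcompl hEP v₃ hv₃ hPort n hn hcyc ψ hψ hcert hzero₁
  have h9 := sq_dvd_card_sha_three_of_exists_selmer_ne_zero hCT W hirr hSel
  exact bsdp_three_potMult_of_sq_dvd_card_sha_of_maninUnit hKatoS hDel hGZK hmod hmodD hKatoχ W hI hΔ hc₄
    hsurj' hjneg hr D hopt hcD h9 ψ₂₇ hunit₁

/-- **END-m1 RECORD COROLLARY, (M) rows, NAMED-FACTS form, at LARGE LEVEL (Manin binder per pair).**
Exactly n1011-p18's `bsdp_three_potMult_of_levelOneCertificates_of_facts` (PT family as the named fact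
`hPT : poitouTate_selmerStructure_duality ℚ`) with `(h26, hN)` replaced by `hcD : ¬ (3 : ℤ) ∣ D.maninConstant`.
CLOSES NOTHING; nothing booked. [cite: Kim2022StructureSelmer, Thm. 1.9 (6) and Thm. 3.13]
[cite: Rubin2011, Thm. 2.8.4] [cite: Delbourgo1998, Prop. 4 (p. 144)] [cite: AgasheRibetStein2006, §2] -/
theorem bsdp_three_potMult_of_levelOneCertificates_of_facts_of_maninUnit
    (hKatoS : Kato2004.rankZero_padicValNat_sha_le_sub_localTamagawa_of_additive_potGood_of_imageContainsSL2)
    (hDel : Delbourgo1998.prop4_rankZero_pow_dvd_constantCoeff)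
    (hGZK : rank_eq_analyticRank_of_analyticRank_le_one) (hmod : hasEntireLFunction_rat)
    (hmodD : nonempty_modularParametrizationData)
    (hKatoχ : Wuthrich2014.kato_halfEigenCharIdeal_dvd_cyclotomicPrime_of_surjective)
    (hCT : exists_casselsTate_pairing (K := ℚ))
    (W : WeierstrassCurve ℚ) [W.IsElliptic] [W.IsGloballyMinimal]
    {E₀ : WeierstrassCurve ℤ} (hI : integralModelInt W = E₀)
    (hΔ : (3 : ℤ) ∣ E₀.Δ) (hc₄ : (3 : ℤ) ∣ E₀.c₄)
    (hsurj : W.HasSurjectiveModNGaloisRep ((3 : ℕ) : ℤ)) (hjneg : padicValRat 3 W.j < 0)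
    (hc3 : ¬ 3 ∣ (W.baseChange ℚ_[3]).localTamagawaNumber ℤ_[3])
    (ht0 : Nat.card {Q : (W.baseChange ℚ_[3]).toAffine.Point // (3 : ℕ) • Q = 0} = 1)
    (hr : W.analyticRank = 0)
    {N : ℕ} [NeZero N] (D : ModularParametrizationData W N)
    (hopt : ∀ z ∈ D.L.lattice, ∃ w ∈ periodLattice D.f, z = D.c * w)
    (hcD : ¬ (3 : ℤ) ∣ D.maninConstant)
    (hPT : poitouTate_selmerStructure_duality ℚ)
    (hEP : ∀ v : HeightOneSpectrum (𝓞 ℚ), localEulerPoincareCharacteristic (v.adicCompletion ℚ))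
    (v₃ : HeightOneSpectrum (𝓞 ℚ)) (hv₃ : ((3 : ℕ) : 𝓞 ℚ) ∈ v₃.asIdeal)
    (hPort : KatoKuriharaPortThreeAt W 0 v₃)
    (n : ℕ) [NeZero n] (hn : Kato.IsKolyvaginProduct W 3 1 n)
    (hcyc : ∀ (ℓ : ℕ) [Fact ℓ.Prime], ℓ ∣ n →
      Nat.card {P : ((integralModelInt W).map (Int.castRingHom (ZMod ℓ))).toAffine.Point //
        3 • P = 0} ≤ 3)
    (ψ : (ℓ : ℕ) → (ZMod ℓ)ˣ →* Multiplicative (ZMod (3 ^ 1)))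
    (hψ : ∀ ℓ ∈ n.primeFactors, Function.Surjective (ψ ℓ))
    (hcert : kuriharaNumber D.f (3 ^ 1) n ψ ≠ 0)
    (hzero₁ : kuriharaNumber D.f (3 ^ 1) 1 ψ = 0)
    (ψ₂₇ : (ℓ : ℕ) → (ZMod ℓ)ˣ →* Multiplicative (ZMod (3 ^ 3)))
    (hunit₁ : kuriharaNumber D.f (3 ^ 3) 1 ψ₂₇ ≠ 0) :
    BSDp W 3 := by
  obtain ⟨inv, hperf, hsum, -, hcompl⟩ := hPT 3
  exact bsdp_three_potMult_of_levelOneCertificates_of_baseRigidity_of_maninUnit hKatoS hDel hGZK hmod hmodD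
    hKatoχ hCT W hI hΔ hc₄ hsurj hjneg hc3 ht0 hr D hopt hcD inv hperf hsum hcompl hEP v₃ hv₃ hPort n hn hcyc
    ψ hψ hcert hzero₁ ψ₂₇ hunit₁


/-! ### The potentially GOOD rows (tower form) at large level -/

/-- **The potentially GOOD socket with the Manin binder**: n1011-p18's `bsdp_three_of_towerSurj_of_sq_dvd_card_sha`
with `(h26, hN)` replaced by `hcD : ¬ (3 : ℤ) ∣ D.maninConstant` — additive-p4's UPPER socket
`X4RankZero.bsdp_of_facts_of_LOmegaWitness` is fed the Manin datum `⟨N, D, hcD⟩` directly instead of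
`exists_maninDatum_of_optimal h26 … hN …` (Wuthrich's Lemma 20 by the tree theorem `…_holds`).  CLOSES NOTHING.
[cite: Kato2004Asterisque, Thm. 14.5 (3) (p. 236), Prop. 14.16 (2) (p. 244)] [cite: Kim2022StructureSelmer, Thm. 1.9 (6)]
[cite: AgasheRibetStein2006, §2] -/
theorem bsdp_three_of_towerSurj_of_sq_dvd_card_sha_of_maninUnit
    (hKatoS : Kato2004.rankZero_padicValNat_sha_le_sub_localTamagawa_of_additive_potGood_of_imageContainsSL2)
    (hDel : Delbourgo1998.prop4_rankZero_pow_dvd_constantCoeff)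
    (hGZK : rank_eq_analyticRank_of_analyticRank_le_one) (hmod : hasEntireLFunction_rat)
    (hmodD : nonempty_modularParametrizationData)
    (hKatoχ : Wuthrich2014.kato_halfEigenCharIdeal_dvd_cyclotomicPrime_of_surjective)
    (W : WeierstrassCurve ℚ) [W.IsElliptic] [W.IsGloballyMinimal]
    {E₀ : WeierstrassCurve ℤ} (hI : integralModelInt W = E₀)
    (hΔ : (3 : ℤ) ∣ E₀.Δ) (hc₄ : (3 : ℤ) ∣ E₀.c₄)
    (htower : ∀ m : ℕ, W.HasSurjectiveModNGaloisRep (3 ^ m : ℕ))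
    (hr : W.analyticRank = 0) (htam : ¬ 3 ∣ W.tamagawaProduct)
    {N : ℕ} [NeZero N] (D : ModularParametrizationData W N)
    (hopt : ∀ z ∈ D.L.lattice, ∃ w ∈ periodLattice D.f, z = D.c * w)
    (hcD : ¬ (3 : ℤ) ∣ D.maninConstant)
    (h9 : 3 ^ 2 ∣ Nat.card (AddCommGroup.primaryComponent W.sha 3))
    (ψ₂₇ : (ℓ : ℕ) → (ZMod ℓ)ˣ →* Multiplicative (ZMod (3 ^ 3)))
    (hunit₁ : kuriharaNumber D.f (3 ^ 3) 1 ψ₂₇ ≠ 0) :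
    BSDp W 3 := by
  haveI : Fact (Nat.Prime 3) := ⟨Nat.prime_three⟩
  have hadd : Addv W 3 := addv_of_intModel hI 3 (by exact_mod_cast hΔ) (by exact_mod_cast hc₄)
  have hsurj : W.HasSurjectiveModNGaloisRep 3 := by simpa using htower 1
  have hX : ClassX4 W 3 :=
    ⟨by norm_num, hadd, hasIrreducibleModPGaloisRep_of_hasSurjectiveModNGaloisRep W 3 hsurj⟩
  obtain ⟨q₀, hq₀, hw⟩ := exists_LOmega_padicValRat_le_of_sq_dvd_card_sha_of_maninUnit hGZK hmod W hsurj
    hr D hopt hcD h9 ψ₂₇ hunit₁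
  exact X4RankZero.bsdp_of_facts_of_LOmegaWitness W 3 hKatoS hDel hGZK hmod hmodD
    Wuthrich2014.lemma20_surjective_threeAdic_of_semistable_holds hKatoχ hr hX hsurj
    (Or.inr ⟨htower, padicValNat_tamagawaProduct_eq_local_of_not_dvd W 3 htam, N, inferInstance, D, hcD⟩)
    hq₀ (j := 0) (Nat.zero_le _) (by simpa using hw)

/-- **END-m1 RECORD COROLLARY, potentially GOOD rows (tower form), [S24]-FREE, at LARGE LEVEL (Manin binder per
pair).**  Exactly n1011-p18's `bsdp_three_of_towerSurj_of_levelOneCertificates_of_baseRigidity` with `(h26) (hN)`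
replaced by `hcD : ¬ (3 : ℤ) ∣ D.maninConstant`; every other binder unchanged and in the same order.  CLOSES NOTHING;
the Kurihara values stay EVIDENCE hypotheses; nothing booked.
[cite: Kim2022StructureSelmer, Thm. 1.9 (6) and Thm. 3.13] [cite: Rubin2011, Thm. 2.8.4]
[cite: Kato2004Asterisque, Thm. 14.5 (3) (p. 236)] [cite: AgasheRibetStein2006, §2] [cite: SilvermanAEC2009, Thm. X.4.14] -/
theorem bsdp_three_of_towerSurj_of_levelOneCertificates_of_baseRigidity_of_maninUnit
    (hKatoS : Kato2004.rankZero_padicValNat_sha_le_sub_localTamagawa_of_additive_potGood_of_imageContainsSL2)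
    (hDel : Delbourgo1998.prop4_rankZero_pow_dvd_constantCoeff)
    (hGZK : rank_eq_analyticRank_of_analyticRank_le_one) (hmod : hasEntireLFunction_rat)
    (hmodD : nonempty_modularParametrizationData)
    (hKatoχ : Wuthrich2014.kato_halfEigenCharIdeal_dvd_cyclotomicPrime_of_surjective)
    (hCT : exists_casselsTate_pairing (K := ℚ))
    (W : WeierstrassCurve ℚ) [W.IsElliptic] [W.IsGloballyMinimal]
    {E₀ : WeierstrassCurve ℤ} (hI : integralModelInt W = E₀)
    (hΔ : (3 : ℤ) ∣ E₀.Δ) (hc₄ : (3 : ℤ) ∣ E₀.c₄)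
    (htower : ∀ m : ℕ, W.HasSurjectiveModNGaloisRep (3 ^ m : ℕ))
    (ht0 : Nat.card {Q : (W.baseChange ℚ_[3]).toAffine.Point // (3 : ℕ) • Q = 0} = 1)
    (hr : W.analyticRank = 0) (htam : ¬ 3 ∣ W.tamagawaProduct)
    {N : ℕ} [NeZero N] (D : ModularParametrizationData W N)
    (hopt : ∀ z ∈ D.L.lattice, ∃ w ∈ periodLattice D.f, z = D.c * w)
    (hcD : ¬ (3 : ℤ) ∣ D.maninConstant)
    (inv : LocalInvariants ℚ 3) (hperf : inv.IsPerfect) (hsum : inv.SumLocalTermEqZero)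
    (hcompl : inv.SelmerComplement)
    (hEP : ∀ v : HeightOneSpectrum (𝓞 ℚ), localEulerPoincareCharacteristic (v.adicCompletion ℚ))
    (v₃ : HeightOneSpectrum (𝓞 ℚ)) (hv₃ : ((3 : ℕ) : 𝓞 ℚ) ∈ v₃.asIdeal)
    (hPort : KatoKuriharaPortThreeAt W 0 v₃)
    (n : ℕ) [NeZero n] (hn : Kato.IsKolyvaginProduct W 3 1 n)
    (hcyc : ∀ (ℓ : ℕ) [Fact ℓ.Prime], ℓ ∣ n →
      Nat.card {P : ((integralModelInt W).map (Int.castRingHom (ZMod ℓ))).toAffine.Point //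
        3 • P = 0} ≤ 3)
    (ψ : (ℓ : ℕ) → (ZMod ℓ)ˣ →* Multiplicative (ZMod (3 ^ 1)))
    (hψ : ∀ ℓ ∈ n.primeFactors, Function.Surjective (ψ ℓ))
    (hcert : kuriharaNumber D.f (3 ^ 1) n ψ ≠ 0)
    (hzero₁ : kuriharaNumber D.f (3 ^ 1) 1 ψ = 0)
    (ψ₂₇ : (ℓ : ℕ) → (ZMod ℓ)ˣ →* Multiplicative (ZMod (3 ^ 3)))
    (hunit₁ : kuriharaNumber D.f (3 ^ 3) 1 ψ₂₇ ≠ 0) :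
    BSDp W 3 := by
  haveI : Fact (Nat.Prime 3) := ⟨Nat.prime_three⟩
  have hadd : Addv W 3 := addv_of_intModel hI 3 (by exact_mod_cast hΔ) (by exact_mod_cast hc₄)
  have hc3 : ¬ 3 ∣ (W.baseChange ℚ_[3]).localTamagawaNumber ℤ_[3] := fun h =>
    htam (h.trans (localTamagawaNumber_padic_dvd_tamagawaProduct W 3))
  have hsurj : W.HasSurjectiveModNGaloisRep ((3 : ℕ) : ℤ) := by simpa using htower 1
  have hsurj' : W.HasSurjectiveModNGaloisRep 3 := by simpa using htower 1
  have hGZ := hGZK W (by rw [hr]; exact zero_le_one)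
  haveI : Finite W.sha := hGZ.2
  haveI : Finite W.toAffine.Point := W.mordellWeilRank_eq_zero_iff_holds.mp (by rw [hGZ.1, hr])
  have hirr : W.HasIrreducibleModPGaloisRep 3 :=
    hasIrreducibleModPGaloisRep_of_hasSurjectiveModNGaloisRep W 3 hsurj'
  have hper : ∃ u : ℚ, ‖(u : ℚ_[3])‖ = 1 ∧ W.realPeriodRat = u * plusPeriod D.f :=
    periodTransfer_of_optimal 3 D hopt hcD
  have hcP : ¬ ((3 : ℕ) : ℤ) ∣ D.maninConstant := by exact_mod_cast hcD
  have hSel := exists_ne_zero_mem_selmerGroup_three_of_port_of_kolyvaginProduct_of_baseRigidity W hadd hc3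
    hsurj ht0 D hcP hper inv hperf hsum hcompl hEP v₃ hv₃ hPort n hn hcyc ψ hψ hcert hzero₁
  have h9 := sq_dvd_card_sha_three_of_exists_selmer_ne_zero hCT W hirr hSel
  exact bsdp_three_of_towerSurj_of_sq_dvd_card_sha_of_maninUnit hKatoS hDel hGZK hmod hmodD hKatoχ W hI hΔ
    hc₄ htower hr htam D hopt hcD h9 ψ₂₇ hunit₁

end Summit.BirchSwinnertonDyer.Rank1Residual.GaloisImage.Assembly

end
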